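import Summits.HubbardSuperconductivity.HubbardSuperconductivity.Theorems.AnisotropyChordXXZHoppingFormula
import Summits.HubbardSuperconductivity.HubbardSuperconductivity.Theorems.PolyaSchurPairBosonSectorPerronXXZ
import Literature.MathematicalPhysics.QuantumLattice.XXZWeighted

/-!
# Route `AnisotropyChord`: the bond-weighted XXZ Hamiltonian — entries, hopping formula and
# sector Perron–Frobenius (toolkit for the weighted two-magnon / THEOREM R wrapper)

For `H = xxzHamiltonianWith n G J Δ = Σ_{e ∈ E(G)} J_e (Sˣ_xSˣ_y + Sʸ_xSʸ_y + Δ Sᶻ_xSᶻ_y)`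
(Literature `XXZWeighted`, bond couplings `J : Sym2 Λ → ℝ`):
* entries (`xxzWith_apply_of_ne`, `xxzWith_apply_self`, any spin `n/2`): off the diagonal
  `⟨σ|H|τ⟩ = Σ_e J_e ⟨σ|𝐒_e|τ⟩` (the anisotropy does not enter), on the diagonal
  `⟨σ|H|σ⟩ = Δ Σ_e J_e (n/2 − σ_x)(n/2 − σ_y)`;
* the stoquastic structure for FERROMAGNETIC couplings `J_e < 0` on every edge: real symmetric
  entries, nonpositive off the diagonal, every Heisenberg hop is a nonzero entry, weight sectors
  invariant — hence **Perron–Frobenius in every magnetisation sector** on a connected graph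
  (`xxzWith_sector_perronFrobenius`, via the abstract `stoquastic_sector_perronFrobenius` of the BEC
  route), the weighted twin of `PolyaSchurPairBoson.xxz_sector_perronFrobenius`;
* the spin-½ **hopping formula** on an arbitrary configuration (`xxzWith_mulVec_apply`):
  `(Hψ)(σ) = Δ·(Σ_e J_e (½−σ_x)(½−σ_y))·ψ(σ) + ½ Σ_{e, σ_x ≠ σ_y} J_e ψ(σ ∘ swap_e)`.
Motivation: the weighted statements of the theory seat `hubbard-h0-rotor-theory-1` (THEOREM R on
rook graphs with direction weights, `WeightedVTSpinMonotone`, two-ring tori) live on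
`xxzHamiltonianWith`; this file is the first layer of the wrapper turning the tree's real-algebra
form of THEOREM R (`wrook_flatOverlap_antitone`) into a statement about sector ground states.
H. Tasaki (2020) §2.4, eq. (2.4.1), (2.4.3); Lieb–Wu, Physica A 321 (2003) §2.  No definition is
introduced.
-/

set_option linter.dupNamespace false

noncomputable section

namespace Summit.HubbardSuperconductivity.HubbardSuperconductivity.Theorems.AnisotropyChord.Weighted

open Matrix Complex Finset
open Literature.MathematicalPhysics.QuantumLattice
open Summit.HubbardSuperconductivity.HubbardSuperconductivity.Theorems.AnisotropyChord.OneMagnon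
  (raise_lower_mulVec_apply)
open Summit.AtomisticToContinuum.BoseEinsteinCondensation.Theorems.BECStronglyRayleighSectorPerron
  (stoquastic_sector_perronFrobenius)

variable {V : Type*} [Fintype V] [DecidableEq V]

/-! ### Entries (any spin) -/

/-- The `z`-bond `½(Sᶻ_xSᶻ_y + Sᶻ_ySᶻ_x)` is diagonal in the occupation basis, with entry
`(n/2 − σ_x)(n/2 − σ_y)`. Tasaki (2020) §2.1 eq. (2.1.5). [folklore] -/
theorem spinBond_two_eq_diagonal (n : ℕ) (x y : V) :
    (spinBond n 2 x y : Op V (n + 1)) =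
      diagonal fun σ => ((n : ℂ) / 2 - ((σ x : ℕ) : ℂ)) * ((n : ℂ) / 2 - ((σ y : ℕ) : ℂ)) := by
  have hsite : ∀ z : V, (siteSpin n z 2 : Op V (n + 1)) =
      diagonal fun σ => (n : ℂ) / 2 - ((σ z : ℕ) : ℂ) := by
    intro z
    rw [siteSpin, spinVec_two, SpinOperators.spinZ, LiebMattis.onSite_diagonal]
  rw [spinBond, hsite, hsite, diagonal_mul_diagonal, diagonal_mul_diagonal, diagonal_add,
    ← diagonal_smul]
  congr 1
  funext σ
  simp only [Pi.smul_apply, smul_eq_mul]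
  ring

/-- The planar bonds in terms of the exchange: `Bˣ_{xy} + Bʸ_{xy} = 𝐒_x·𝐒_y − Bᶻ_{xy}`
(definition of `spinDot` as the sum of the three bonds). [folklore] -/
theorem spinBond_zero_add_one_eq_spinDot_sub (n : ℕ) (x y : V) :
    (spinBond n 0 x y + spinBond n 1 x y : Op V (n + 1)) = spinDot n x y - spinBond n 2 x y := by
  rw [spinDot, Fin.sum_univ_three]
  abel

/-- **Off-diagonal entries of the weighted XXZ Hamiltonian** do not see the anisotropy:
`⟨σ|H|τ⟩ = Σ_e J_e ⟨σ|𝐒_e|τ⟩` for `σ ≠ τ`. Tasaki (2020) §2.4, eq. (2.4.3). [folklore] -/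
theorem xxzWith_apply_of_ne (n : ℕ) (G : SimpleGraph V) [DecidableRel G.Adj] (J : Sym2 V → ℝ)
    (Δ : ℝ) {σ τ : TensorIndex V (n + 1)} (hστ : σ ≠ τ) :
    xxzHamiltonianWith n G J Δ σ τ = ∑ e ∈ G.edgeFinset, (J e : ℂ) * spinDotSym n e σ τ := by
  rw [xxzHamiltonianWith, Matrix.sum_apply]
  refine Finset.sum_congr rfl fun e _ => ?_
  rw [Matrix.smul_apply, smul_eq_mul]
  congr 1
  induction e using Sym2.ind with
  | h x y =>
    simp only [Sym2.lift_mk, spinDotSym_mk]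
    rw [Matrix.add_apply, Matrix.smul_apply, spinBond_zero_add_one_eq_spinDot_sub, Matrix.sub_apply,
      spinBond_two_eq_diagonal, diagonal_apply_ne _ hστ, smul_zero, sub_zero, add_zero]

/-- **Diagonal entries of the weighted XXZ Hamiltonian**: `⟨σ|H|σ⟩ = Δ Σ_e J_e (n/2−σ_x)(n/2−σ_y)`
(only the Ising part is diagonal; the planar bonds have zero diagonal). Tasaki (2020) §2.4.
[folklore] -/
theorem xxzWith_apply_self (n : ℕ) (G : SimpleGraph V) [DecidableRel G.Adj] (J : Sym2 V → ℝ)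
    (Δ : ℝ) (σ : TensorIndex V (n + 1)) :
    xxzHamiltonianWith n G J Δ σ σ = ((Δ * ∑ e ∈ G.edgeFinset, J e *
      Sym2.lift ⟨fun x y => ((n : ℝ) / 2 - (σ x : ℕ)) * ((n : ℝ) / 2 - (σ y : ℕ)),
        fun _ _ => mul_comm _ _⟩ e : ℝ) : ℂ) := by
  rw [xxzHamiltonianWith, Matrix.sum_apply]
  push_cast
  rw [Finset.mul_sum]
  refine Finset.sum_congr rfl fun e he => ?_
  rw [Matrix.smul_apply, smul_eq_mul]
  revert he
  induction e using Sym2.ind with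
  | h x y =>
    intro he
    rw [SimpleGraph.mem_edgeFinset, SimpleGraph.mem_edgeSet] at he
    have hxy : x ≠ y := he.ne
    simp only [Sym2.lift_mk]
    rw [Matrix.add_apply, Matrix.smul_apply, spinBond_zero_add_one_eq_spinDot_sub, Matrix.sub_apply,
      spinBond_two_eq_diagonal, diagonal_apply_eq, LiebMattis.spinDot_apply_self n hxy, sub_self, zero_add,
      smul_eq_mul]
    push_cast
    ring

/-- **Stoquastic structure of the ferromagnetic weighted XXZ Hamiltonian** (`J_e < 0` on every
edge): every Heisenberg hop is a nonzero entry; entries are real and symmetric; off-diagonal entries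
have nonpositive real part; entries between different weights vanish.  Marshall (1955);
Tasaki (2020) §2.4, proof of Thm 2.3; Lieb–Wu (2003) §2. [folklore] -/
theorem xxzWith_entries (n : ℕ) (G : SimpleGraph V) [DecidableRel G.Adj] (J : Sym2 V → ℝ)
    (hJ : ∀ e ∈ G.edgeFinset, J e < 0) (Δ : ℝ) :
    (∀ σ τ : TensorIndex V (n + 1), σ ≠ τ → heisenbergHamiltonian n G 1 σ τ ≠ 0 →
        xxzHamiltonianWith n G J Δ σ τ ≠ 0) ∧
    (∀ σ τ : TensorIndex V (n + 1),
        star (xxzHamiltonianWith n G J Δ σ τ) = xxzHamiltonianWith n G J Δ σ τ) ∧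
    (∀ σ τ : TensorIndex V (n + 1),
        xxzHamiltonianWith n G J Δ σ τ = xxzHamiltonianWith n G J Δ τ σ) ∧
    (∀ σ τ : TensorIndex V (n + 1), σ ≠ τ → (xxzHamiltonianWith n G J Δ σ τ).re ≤ 0) ∧
    (∀ σ τ : TensorIndex V (n + 1), (∑ z, (σ z : ℕ)) ≠ (∑ z, (τ z : ℕ)) →
        xxzHamiltonianWith n G J Δ σ τ = 0) := by
  -- the off-diagonal entries as a real combination of the nonnegative hop amplitudes
  have hoffd : ∀ σ τ : TensorIndex V (n + 1), σ ≠ τ →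
      ∃ t : Sym2 V → ℝ, (∀ e ∈ G.edgeFinset, 0 ≤ t e) ∧
        (∀ e ∈ G.edgeFinset, spinDotSym n e σ τ = t e) ∧
        xxzHamiltonianWith n G J Δ σ τ = ((∑ e ∈ G.edgeFinset, J e * t e : ℝ) : ℂ) := by
    intro σ τ hστ
    have hterm : ∀ e ∈ G.edgeFinset, ∃ t : ℝ, 0 ≤ t ∧ spinDotSym n e σ τ = t := by
      intro e he
      obtain ⟨t, ht, ht0⟩ := LiebMattis.spinDotSym_apply_eq_real n G he σ τ
      exact ⟨t, ht0 hστ, ht⟩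
    choose! t ht0 ht using hterm
    refine ⟨t, ht0, ht, ?_⟩
    rw [xxzWith_apply_of_ne n G J Δ hστ]
    push_cast
    exact Finset.sum_congr rfl fun e he => by rw [ht e he]
  have hreal : ∀ σ τ : TensorIndex V (n + 1),
      star (xxzHamiltonianWith n G J Δ σ τ) = xxzHamiltonianWith n G J Δ σ τ := by
    intro σ τ
    by_cases hστ : σ = τ
    · subst hστ
      rw [xxzWith_apply_self, Complex.star_def, Complex.conj_ofReal]
    · obtain ⟨t, -, -, h⟩ := hoffd σ τ hστ
      rw [h, Complex.star_def, Complex.conj_ofReal]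
  have hHerm := xxzHamiltonianWith_isHermitian n G J Δ
  refine ⟨?_, hreal, fun σ τ => by rw [← hHerm.apply σ τ, hreal], ?_, ?_⟩
  · -- hops are nonzero entries
    intro σ τ hστ hhop
    obtain ⟨t, ht0, hte, h⟩ := hoffd σ τ hστ
    rw [LiebMattis.heisenbergHamiltonian_apply, Complex.ofReal_one, one_mul] at hhop
    have hsum : (∑ e ∈ G.edgeFinset, spinDotSym n e σ τ) = ((∑ e ∈ G.edgeFinset, t e : ℝ) : ℂ) := by
      push_cast; exact Finset.sum_congr rfl fun e he => hte e he
    rw [hsum, Ne, Complex.ofReal_eq_zero] at hhop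
    obtain ⟨e₀, he₀, hne⟩ := Finset.exists_ne_zero_of_sum_ne_zero hhop
    have hpos : 0 < ∑ e ∈ G.edgeFinset, (-J e) * t e :=
      Finset.sum_pos' (fun e he => mul_nonneg (by linarith [hJ e he]) (ht0 e he))
        ⟨e₀, he₀, mul_pos (by linarith [hJ e₀ he₀]) (lt_of_le_of_ne (ht0 e₀ he₀) (Ne.symm hne))⟩
    rw [h, Ne, Complex.ofReal_eq_zero]
    have : ∑ e ∈ G.edgeFinset, (-J e) * t e = -∑ e ∈ G.edgeFinset, J e * t e := by
      rw [← Finset.sum_neg_distrib]; exact Finset.sum_congr rfl fun e _ => by ring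
    linarith
  · -- off-diagonal sign
    intro σ τ hστ
    obtain ⟨t, ht0, -, h⟩ := hoffd σ τ hστ
    rw [h, Complex.ofReal_re]
    exact Finset.sum_nonpos fun e he => mul_nonpos_of_nonpos_of_nonneg (hJ e he).le (ht0 e he)
  · -- weight sectors
    intro σ τ hw
    have hστ : σ ≠ τ := fun h => hw (by rw [h])
    obtain ⟨t, ht0, hte, h⟩ := hoffd σ τ hστ
    have hz := LiebMattis.heisenbergHamiltonian_apply_eq_zero_of_weight_ne n G 1 hw
    rw [LiebMattis.heisenbergHamiltonian_apply, Complex.ofReal_one, one_mul] at hz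
    have hsum : ((∑ e ∈ G.edgeFinset, t e : ℝ) : ℂ) = 0 := by
      rw [← hz]; push_cast; exact Finset.sum_congr rfl fun e he => (hte e he).symm
    rw [Complex.ofReal_eq_zero] at hsum
    have hall := (Finset.sum_eq_zero_iff_of_nonneg fun e he => ht0 e he).mp hsum
    rw [h, Complex.ofReal_eq_zero]
    exact Finset.sum_eq_zero fun e he => by rw [hall e he, mul_zero]

/-- **Perron–Frobenius in a magnetisation sector of the ferromagnetic bond-weighted XXZ
Hamiltonian** on a connected graph, any anisotropy: for `J_e < 0` on every edge and every attained
weight `W`, the sector `S³_tot = |V|·n/2 − W` of `xxzHamiltonianWith n G J Δ` has a nonzero entrywise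
real-nonnegative ground vector, unique up to scalars among sector ground vectors — the abstract
stoquastic sector theorem `stoquastic_sector_perronFrobenius` fed with `xxzWith_entries`.  Weighted
twin of `PolyaSchurPairBoson.xxz_sector_perronFrobenius`.  Tasaki (2020) §2.4; Lieb–Wu (2003) §2.
[folklore] -/
theorem xxzWith_sector_perronFrobenius (n : ℕ) (G : SimpleGraph V) [DecidableRel G.Adj]
    (hG : G.Connected) (J : Sym2 V → ℝ) (hJ : ∀ e ∈ G.edgeFinset, J e < 0) (Δ : ℝ) (W : ℕ)
    (hW : ∃ σ : TensorIndex V (n + 1), (∑ z, (σ z : ℕ)) = W) :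
    (∃ ψ ∈ spinZSector (Λ := V) n (((Fintype.card V * n : ℕ) : ℝ) / 2 - W), ψ ≠ 0 ∧
      (∀ σ, 0 ≤ (ψ σ).re ∧ (ψ σ).im = 0) ∧
      xxzHamiltonianWith n G J Δ *ᵥ ψ =
        ((lowestEnergyInSector n (xxzHamiltonianWith n G J Δ)
          (((Fintype.card V * n : ℕ) : ℝ) / 2 - W) : ℝ) : ℂ) • ψ) ∧
    (∀ ψ φ : TensorIndex V (n + 1) → ℂ,
      ψ ∈ spinZSector (Λ := V) n (((Fintype.card V * n : ℕ) : ℝ) / 2 - W) →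
      φ ∈ spinZSector (Λ := V) n (((Fintype.card V * n : ℕ) : ℝ) / 2 - W) →
      xxzHamiltonianWith n G J Δ *ᵥ ψ =
        ((lowestEnergyInSector n (xxzHamiltonianWith n G J Δ)
          (((Fintype.card V * n : ℕ) : ℝ) / 2 - W) : ℝ) : ℂ) • ψ →
      xxzHamiltonianWith n G J Δ *ᵥ φ =
        ((lowestEnergyInSector n (xxzHamiltonianWith n G J Δ)
          (((Fintype.card V * n : ℕ) : ℝ) / 2 - W) : ℝ) : ℂ) • φ →
      ψ ≠ 0 → ∃ c : ℂ, φ = c • ψ) := by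
  obtain ⟨hhop, hreal, hsymm, hoff, hwt⟩ := xxzWith_entries n G J hJ Δ
  exact stoquastic_sector_perronFrobenius n G hG (xxzHamiltonianWith n G J Δ) hhop hreal hsymm hoff hwt W hW

/-! ### The spin-½ hopping formula -/

/-- Per-edge action on a spin-½ configuration (`x ≠ y`):
`((Bˣ + Bʸ + Δ Bᶻ)ψ)(σ) = Δ(½−σ_x)(½−σ_y)ψ(σ) + ½[σ_x ≠ σ_y] ψ(σ ∘ swap_{xy})`.
Tasaki (2020) §2.4, eq. (2.4.3). [folklore] -/
theorem xxzEdgeTerm_mulVec_apply {x y : V} (hxy : x ≠ y) (Δ : ℝ) (ψ : (V → Fin 2) → ℂ)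
    (σ : V → Fin 2) :
    ((spinBond 1 0 x y + spinBond 1 1 x y + (Δ : ℂ) • spinBond 1 2 x y : Op V 2) *ᵥ ψ) σ =
      ((Δ * (((1 : ℝ) / 2 - (σ x : ℕ)) * ((1 : ℝ) / 2 - (σ y : ℕ))) : ℝ) : ℂ) * ψ σ
        + (1 / 2 : ℂ) * (if σ x ≠ σ y then ψ (σ ∘ Equiv.swap x y) else 0) := by
  -- the planar part via the exchange: `Bˣ + Bʸ = ½(S⁺_xS⁻_y + S⁻_xS⁺_y)`
  have hZ : (spinBond 1 2 x y : Op V 2) =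
      onSite x (SpinOperators.spinZ 1) * onSite y (SpinOperators.spinZ 1) := by
    rw [spinBond_two_eq_diagonal, SpinOperators.spinZ, LiebMattis.onSite_diagonal,
      LiebMattis.onSite_diagonal, diagonal_mul_diagonal, Nat.cast_one]
  have h01 : (spinBond 1 0 x y + spinBond 1 1 x y : Op V 2) =
      (1 / 2 : ℂ) • (onSite x (spinRaise 1) * onSite y (spinLower 1) +
        onSite x (spinLower 1) * onSite y (spinRaise 1)) := by
    rw [spinBond_zero_add_one_eq_spinDot_sub, LiebMattis.spinDot_eq_of_ne 1 hxy, hZ, add_sub_cancel_left]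
  rw [Matrix.add_mulVec, Pi.add_apply, h01, Matrix.smul_mulVec, Pi.smul_apply, Matrix.add_mulVec,
    Pi.add_apply, raise_lower_mulVec_apply hxy, smul_eq_mul]
  have hcomm : (onSite x (spinLower 1) * onSite y (spinRaise 1) : Op V 2) =
      onSite y (spinRaise 1) * onSite x (spinLower 1) := onSite_mul_onSite_comm hxy _ _
  rw [hcomm, raise_lower_mulVec_apply (Ne.symm hxy), Matrix.smul_mulVec, Pi.smul_apply,
    spinBond_two_eq_diagonal, mulVec_diagonal, smul_eq_mul, Equiv.swap_comm y x]
  have fin_two_eq_zero_or_one : ∀ t : Fin 2, t = 0 ∨ t = 1 := by decide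
  push_cast
  rcases fin_two_eq_zero_or_one (σ x) with hx | hx <;>
    rcases fin_two_eq_zero_or_one (σ y) with hy | hy <;> simp [hx, hy] <;> try ring

/-- **Hopping formula for the spin-½ bond-weighted XXZ Hamiltonian** on an arbitrary
configuration: `(Hψ)(σ) = Δ·(Σ_e J_e(½−σ_x)(½−σ_y))·ψ(σ) + ½ Σ_{e ∈ E, σ_x ≠ σ_y} J_e ψ(σ ∘ swap_e)`
— weighted Ising diagonal plus weighted nearest-neighbour hops.  Tasaki (2020) §2.4. [folklore] -/
theorem xxzWith_mulVec_apply (G : SimpleGraph V) [DecidableRel G.Adj] (J : Sym2 V → ℝ) (Δ : ℝ)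
    (ψ : (V → Fin 2) → ℂ) (σ : V → Fin 2) :
    ((xxzHamiltonianWith 1 G J Δ : Op V 2) *ᵥ ψ) σ =
      ((Δ * ∑ e ∈ G.edgeFinset, J e * Sym2.lift ⟨fun x y => ((1 : ℝ) / 2 - (σ x : ℕ)) *
          ((1 : ℝ) / 2 - (σ y : ℕ)), fun _ _ => mul_comm _ _⟩ e : ℝ) : ℂ) * ψ σ
        + (1 / 2 : ℂ) * ∑ e ∈ G.edgeFinset, (J e : ℂ) *
            Sym2.lift ⟨fun x y => if σ x ≠ σ y then ψ (σ ∘ Equiv.swap x y) else 0, fun x y => by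
              simp only [ne_comm, Equiv.swap_comm]⟩ e := by
  rw [xxzHamiltonianWith, Matrix.sum_mulVec, Finset.sum_apply]
  push_cast
  rw [Finset.mul_sum, Finset.mul_sum, Finset.sum_mul, ← Finset.sum_add_distrib]
  refine Finset.sum_congr rfl fun e he => ?_
  revert he
  induction e using Sym2.ind with
  | h x y =>
    intro he
    rw [SimpleGraph.mem_edgeFinset, SimpleGraph.mem_edgeSet] at he
    have hxy : x ≠ y := he.ne
    rw [Matrix.smul_mulVec, Pi.smul_apply, smul_eq_mul]
    simp only [Sym2.lift_mk]
    rw [xxzEdgeTerm_mulVec_apply hxy]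
    push_cast
    ring

end Summit.HubbardSuperconductivity.HubbardSuperconductivity.Theorems.AnisotropyChord.Weighted
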